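import Summits.ResolutionOfSingularities.ResolutionOfSingularities.Theorems.FrobeniusLadderFInjectiveMacaulayficationF4Isolated
import Summits.ResolutionOfSingularities.ResolutionOfSingularities.Theorems.FrobeniusLadderFInjectiveMacaulayficationPrimeTransfer
import Summits.ResolutionOfSingularities.ResolutionOfSingularities.Theorems.FrobeniusLadderFInjectiveMacaulayficationThreefoldNotDvd
import Mathlib.RingTheory.MvPolynomial.WeightedHomogeneous
import Mathlib.Algebra.MvPolynomial.PDeriv
import Mathlib.Algebra.Ring.GeomSum
import Mathlib.Data.Nat.Prime.Factorial
import Mathlib.Tactic.LinearCombination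
import HarnessLib

/-!
# The corner-G1 specimen `z² + x³y² + y³` as input data of the graded engine, at every ODD prime
(crux `FInjectiveMacaulayfication`, line `graded-engine`, calibration G6d)

[OURS · L1 W4.5a] Support file for crux stmt-ResolutionOfSingularities-15315
(`Summit.ResolutionOfSingularities.ResolutionOfSingularities.Theses.FrobeniusLadder.FInjectiveMacaulayfication`, route
`FrobeniusLadder`, skeleton v11 `86e9127b5c98b8e6`, line `graded-engine`).  Calibration G6d of CHAIN w45a v3.8: tri-1's CORNER-G1
SPECIMEN (TRIAGE §10) `g = X₂² + X₀³X₁² + X₁³` ("`z² + x³y² + y³`"), quasi-homogeneous for `w = (2,6,9)` of degree `18`, whose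
singular locus is the LINE `L = {X₁ = X₂ = 0}` (so `V(g)` is NOT normal at the origin `b`), transversal type `A₁ × line` along
`L ∖ b` at odd `p`, `b` not F-pure; tri-1: `Bl_b` fails at every odd `p`, the `(2,6,9)`-weighted centre works.  This file
certifies the INPUT DATA of the graded engine G5 (`stub_gradedConeFiModel`) for `g` at every odd prime, uniformly in `p`:
§1 `g1_isWeightedHomogeneous` (degree `18`), `pderiv_two_g`, `pderiv_one_g`; §2 `prime_g` / `isPrime_span_g` (`T² + c` with `-c`
a non-square by the odd-degree test, `E8Forms.prime_and_not_dvd_of_ringEquiv`), `g_X_ne_zero`; §3 `g_pow_sub_mem` — the Fedder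
congruence at `p = 2m+1` in any commutative ring: `g^(p-1) ≡ C(2m,m)·x^{3m}y^{2m}z^{2m}` modulo every ideal containing `y^p, z^p`
(binomial theorem on `z² + y²(x³+y)`; `(x³+y)^m ≡ x^{3m} mod y`), `choose_ne_zero` (`C(2m,m) ≠ 0` in characteristic `p`),
`monomial_notMem_span_pow` — the uniform witness along `L`: `x^{3m}y^{2m}z^{2m} ∉ (c(x)^p, y^p, z^p)` for every non-unit
`c ∈ k[T]` coprime to `T` (coefficient extraction, as in `F4Isolated`); §4 `g1Corner_offOrigin_clause` — **the off-origin
clause `hoff` at every ODD `p`**: Jacobian (`ClauseOfPderivNotMem`) unless `X₁, X₂ ∈ P ∌ X₀`, where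
`P = (c(X₀), X₁, X₂)` (`FedderAlongCoordinateLine.exists_eq_span_of_X_mem`) and Fedder's test holds by §3
(`FedderAtMaximalIdeal.stub_fedderAtMaximalIdeal`).  The follow-up file `G1CornerGradedFiModel` applies G5 (`N = 18`,
`c = (9,3,2)`, splitting `G1CornerVeroneseSplitting`).  Folklore algebra over the landed Fedder / Jacobian dischargers
([Fedder1983] Prop. 1.7, Thm. 1.12; [Matsumura1987] Thm. 30.4).  No definition is declared; AI-written, weaker than expert
review; no statement of [claim: Hironaka2017] is used.
-/

-- single-problem summit: the doubled namespace component is forced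
set_option linter.dupNamespace false

noncomputable section

namespace Summit.ResolutionOfSingularities.ResolutionOfSingularities.Theorems.FInjectiveMacaulayfication.G1CornerGradedData

open MvPolynomial
open Summit.ResolutionOfSingularities.ResolutionOfSingularities.Theorems.FInjectiveMacaulayfication

/-! ## §1 Homogeneity and partial derivatives -/

/-- **`g = X₂² + X₀³X₁² + X₁³` is weighted homogeneous of degree `18` for `w = (2,6,9)`** (`9·2 = 2·3 + 6·2 = 6·3 = 18`).
[folklore] -/
theorem g1_isWeightedHomogeneous (k : Type) [Field k] :
    MvPolynomial.IsWeightedHomogeneous (![2, 6, 9] : Fin 3 → ℕ)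
      (X 2 ^ 2 + X 0 ^ 3 * X 1 ^ 2 + X 1 ^ 3 : MvPolynomial (Fin 3) k) 18 := by
  refine ((?_ : IsWeightedHomogeneous _ _ 18).add ?_).add ?_
  · simpa using (isWeightedHomogeneous_X k (![2, 6, 9] : Fin 3 → ℕ) 2).pow 2
  · simpa using ((isWeightedHomogeneous_X k (![2, 6, 9] : Fin 3 → ℕ) 0).pow 3).mul
      ((isWeightedHomogeneous_X k (![2, 6, 9] : Fin 3 → ℕ) 1).pow 2)
  · simpa using (isWeightedHomogeneous_X k (![2, 6, 9] : Fin 3 → ℕ) 1).pow 3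

/-- **`∂g/∂X₂ = 2X₂`**, over any commutative ring. [folklore] -/
theorem pderiv_two_g {A : Type*} [CommRing A] :
    pderiv 2 (X 2 ^ 2 + X 0 ^ 3 * X 1 ^ 2 + X 1 ^ 3 : MvPolynomial (Fin 3) A) = 2 * X 2 := by
  simp only [map_add, Derivation.leibniz, pderiv_pow, pderiv_X_self,
    pderiv_X_of_ne (show (0 : Fin 3) ≠ 2 by decide), pderiv_X_of_ne (show (1 : Fin 3) ≠ 2 by decide),
    Nat.reduceSub, pow_one, mul_one, mul_zero, smul_zero, add_zero, Nat.cast_ofNat]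

/-- **`∂g/∂X₁ = 2X₀³X₁ + 3X₁²`**, over any commutative ring. [folklore] -/
theorem pderiv_one_g {A : Type*} [CommRing A] :
    pderiv 1 (X 2 ^ 2 + X 0 ^ 3 * X 1 ^ 2 + X 1 ^ 3 : MvPolynomial (Fin 3) A) =
      2 * (X 0 ^ 3 * X 1) + 3 * X 1 ^ 2 := by
  simp only [map_add, Derivation.leibniz, pderiv_pow, pderiv_X_self,
    pderiv_X_of_ne (show (0 : Fin 3) ≠ 1 by decide), pderiv_X_of_ne (show (2 : Fin 3) ≠ 1 by decide),
    Nat.reduceSub, pow_one, mul_one, mul_zero, zero_add, add_zero, smul_eq_mul, Nat.cast_ofNat]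
  ring

/-! ## §2 Primality; no variable lies in `(g)` -/

/-- **`g = X₂² + X₀³X₁² + X₁³` is prime over every field.** Identify `k[X₀,X₁,X₂]` with `k[Y₀,Y₁][T]` by `X₂ ↦ T`,
`X₀ ↦ Y₁`, `X₁ ↦ Y₀` (`renameEquiv (swap 0 2)` then `finSuccEquiv`); `g ↦ T² + c` with `c = Y₁³Y₀² + Y₀³`, and `-c` is not
a square (`Y₁ ↦ 0`, `Y₀ ↦ -T` evaluates `c` to `-T³`), so `E8Forms.prime_and_not_dvd_of_ringEquiv` applies. [folklore] -/
-- adapted from `E8Forms.stub_e8Forms` / `F4Isolated.prime_f4`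
theorem prime_g (k : Type) [Field k] (g : MvPolynomial (Fin 3) k)
    (hg : g = X 2 ^ 2 + X 0 ^ 3 * X 1 ^ 2 + X 1 ^ 3) : Prime g := by
  obtain ⟨e, he0, he1, he2⟩ : ∃ e : MvPolynomial (Fin 3) k ≃+* Polynomial (MvPolynomial (Fin 2) k),
      e (X 0) = Polynomial.C (X 1) ∧ e (X 1) = Polynomial.C (X 0) ∧ e (X 2) = Polynomial.X := by
    refine ⟨((renameEquiv k (Equiv.swap (0 : Fin 3) 2)).trans (finSuccEquiv k 2)).toRingEquiv, ?_, ?_, ?_⟩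
    · show finSuccEquiv k 2 (rename (Equiv.swap (0 : Fin 3) 2) (X 0)) = _
      rw [rename_X, Equiv.swap_apply_left]
      exact finSuccEquiv_X_succ (j := 1)
    · show finSuccEquiv k 2 (rename (Equiv.swap (0 : Fin 3) 2) (X 1)) = _
      rw [rename_X, Equiv.swap_apply_of_ne_of_ne (by decide) (by decide)]
      exact finSuccEquiv_X_succ (j := 0)
    · show finSuccEquiv k 2 (rename (Equiv.swap (0 : Fin 3) 2) (X 2)) = _
      rw [rename_X, Equiv.swap_apply_right]
      exact finSuccEquiv_X_zero
  have heg : e g = Polynomial.X ^ 2 + Polynomial.C (X 1 ^ 3 * X 0 ^ 2 + X 0 ^ 3) := by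
    subst hg
    simp only [map_add, map_mul, map_pow, he0, he1, he2]
    ring
  have hc : ∀ a : MvPolynomial (Fin 2) k, a * a ≠ -(X 1 ^ 3 * X 0 ^ 2 + X 0 ^ 3) :=
    F4Isolated.mul_self_ne_neg_of_aeval ![-Polynomial.X, 0] 1 (by
      simp only [map_add, map_mul, map_pow, MvPolynomial.aeval_X, Matrix.cons_val_zero, Matrix.cons_val_one]
      ring)
  exact (E8Forms.prime_and_not_dvd_of_ringEquiv e g _ heg hc).1

/-- `(g)` is a prime ideal, over every field. [folklore] -/
theorem isPrime_span_g (k : Type) [Field k] (g : MvPolynomial (Fin 3) k)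
    (hg : g = X 2 ^ 2 + X 0 ^ 3 * X 1 ^ 2 + X 1 ^ 3) : (Ideal.span {g}).IsPrime :=
  (Ideal.span_singleton_prime (prime_g k g hg).ne_zero).mpr (prime_g k g hg)

/-- **No variable lies in `(g)`**: evaluate at a point with `X_v = 0` and `g = 1` (`(0,0,1)` for `v = 0, 1`, `(0,1,0)` for
`v = 2`). [folklore] -/
theorem g_X_ne_zero (k : Type) [Field k] (g : MvPolynomial (Fin 3) k)
    (hg : g = X 2 ^ 2 + X 0 ^ 3 * X 1 ^ 2 + X 1 ^ 3) (v : Fin 3) :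
    Ideal.Quotient.mk (Ideal.span {g}) (MvPolynomial.X v) ≠ 0 := by
  intro h
  refine PrimeTransfer.X_not_mem_span_of_isPrime (isPrime_span_g k g hg) ?_ (Ideal.Quotient.eq_zero_iff_mem.mp h)
  by_cases hv : v = 2
  · subst hv
    refine ThreefoldNotDvd.not_mem_span_X_of_eval_eq_one 2 ![0, 1, 0] rfl ?_
    subst hg; simp
  · refine ThreefoldNotDvd.not_mem_span_X_of_eval_eq_one v ![0, 0, 1] ?_ ?_
    · fin_cases v <;> simp_all
    · subst hg; simp

/-! ## §3 Fedder's congruence at an arbitrary odd exponent, and the uniform witness along the singular line -/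

/-- **Fedder congruence for `g = z² + x³y² + y³` at `p = 2m+1`**, in any commutative ring: modulo every ideal `J`
containing `y^p` and `z^p`, `g^(p-1) ≡ C(2m, m) · x^{3m} y^{2m} z^{2m}`.  Binomial theorem on `g = z² + y²(x³+y)`: the
term `C(2m,i) z^{2i} (y²(x³+y))^{2m-i}` lies in `J` unless `i = m` (`z^{2i}` for `i > m`, `y^{2(2m-i)}` for `i < m`), and
`(x³+y)^m ≡ x^{3m} mod y` kills the rest of the middle term against `y^{2m}`. [folklore] -/
theorem g_pow_sub_mem {A : Type*} [CommRing A] (m : ℕ) (x y z : A) (J : Ideal A)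
    (hy : y ^ (2 * m + 1) ∈ J) (hz : z ^ (2 * m + 1) ∈ J) :
    (z ^ 2 + x ^ 3 * y ^ 2 + y ^ 3) ^ (2 * m) -
      ((2 * m).choose m : A) * (x ^ (3 * m) * y ^ (2 * m) * z ^ (2 * m)) ∈ J := by
  rw [← Ideal.Quotient.eq_zero_iff_mem, map_sub]
  have hy' : Ideal.Quotient.mk J y ^ (2 * m + 1) = 0 := by
    rw [← map_pow, Ideal.Quotient.eq_zero_iff_mem.mpr hy]
  have hz' : Ideal.Quotient.mk J z ^ (2 * m + 1) = 0 := by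
    rw [← map_pow, Ideal.Quotient.eq_zero_iff_mem.mpr hz]
  simp only [map_pow, map_add, map_mul, map_natCast]
  generalize Ideal.Quotient.mk J x = a at *
  generalize Ideal.Quotient.mk J y = b at *
  generalize Ideal.Quotient.mk J z = c at *
  -- binomial expansion of `(c² + b²(a³+b))^(2m)`: only the middle term survives
  have hgb : c ^ 2 + a ^ 3 * b ^ 2 + b ^ 3 = c ^ 2 + b ^ 2 * (a ^ 3 + b) := by ring
  have hsum : (c ^ 2 + b ^ 2 * (a ^ 3 + b)) ^ (2 * m) =
      (c ^ 2) ^ m * (b ^ 2 * (a ^ 3 + b)) ^ (2 * m - m) * ((2 * m).choose m : A ⧸ J) := by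
    rw [add_pow, Finset.sum_eq_single m]
    · intro i hi him
      rw [Finset.mem_range] at hi
      rcases Nat.lt_or_gt_of_ne him with hlt | hgt
      · -- `i < m`: the factor `b^(2(2m-i))` vanishes
        have e1 : (b ^ 2 * (a ^ 3 + b)) ^ (2 * m - i) =
            b ^ (2 * m + 1) * (b ^ (2 * (2 * m - i) - (2 * m + 1)) * (a ^ 3 + b) ^ (2 * m - i)) := by
          rw [mul_pow, ← pow_mul, ← mul_assoc, ← pow_add]
          congr 2
          omega
        rw [e1, hy']
        ring
      · -- `m < i`: the factor `c^(2i)` vanishes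
        have e1 : (c ^ 2) ^ i = c ^ (2 * m + 1) * c ^ (2 * i - (2 * m + 1)) := by
          rw [← pow_mul, ← pow_add]
          congr 1
          omega
        rw [e1, hz']
        ring
    · intro hm
      exfalso
      exact hm (Finset.mem_range.mpr (by omega))
  -- `(a³ + b)^m ≡ a^{3m} mod b`
  obtain ⟨r, hr⟩ : b ∣ (a ^ 3 + b) ^ m - (a ^ 3) ^ m := by
    have h := sub_dvd_pow_sub_pow (a ^ 3 + b) (a ^ 3) m
    rwa [add_sub_cancel_left] at h
  have hmid : (b ^ 2 * (a ^ 3 + b)) ^ (2 * m - m) = b ^ (2 * m) * (a ^ (3 * m) + b * r) := by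
    rw [show 2 * m - m = m by omega, mul_pow, ← pow_mul, eq_add_of_sub_eq hr, ← pow_mul]
    ring
  rw [hgb, hsum, hmid]
  have e2 : (c ^ 2) ^ m * (b ^ (2 * m) * (a ^ (3 * m) + b * r)) * ((2 * m).choose m : A ⧸ J) -
      ((2 * m).choose m : A ⧸ J) * (a ^ (3 * m) * b ^ (2 * m) * c ^ (2 * m)) =
      ((2 * m).choose m : A ⧸ J) * r * c ^ (2 * m) * b ^ (2 * m + 1) := by
    ring
  rw [e2, hy', mul_zero]

/-- **The central binomial coefficient `C(2m, m)` is non-zero in characteristic `p = 2m + 1`** (it divides `(2m)!`,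
which `p > 2m` does not divide). [folklore] -/
theorem choose_ne_zero (p : ℕ) [hp : Fact p.Prime] (m : ℕ) (hm : p = 2 * m + 1) (k : Type) [Field k] [CharP k p] :
    (((2 * m).choose m : ℕ) : k) ≠ 0 := by
  intro h
  rw [CharP.cast_eq_zero_iff k p] at h
  have hdvd : (2 * m).choose m ∣ (2 * m).factorial := by
    have e := Nat.choose_mul_factorial_mul_factorial (show m ≤ 2 * m by omega)
    exact Dvd.intro _ (by rw [mul_assoc] at e; exact e)
  have h2 : p ∣ (2 * m).factorial := h.trans hdvd
  rw [hp.out.dvd_factorial] at h2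
  omega

/-- **The uniform Fedder witness along the singular line `L = {X₁ = X₂ = 0}`.** For a field `k`, `p = 2m + 1` and ANY
non-unit `c ∈ k[T]` coprime to `T`, the monomial `X₀^{3m} X₁^{2m} X₂^{2m}` does not lie in `(c(X₀)^p, X₁^p, X₂^p)`: the
`X₁^{2m}X₂^{2m}`-extraction `E : k[X] →+ k[T]` along the line `ℓ = 0` (`FedderAlongCoordinateLine.exists_extraction`)
kills the multiples of `X₁^p, X₂^p` (exponents `2m < p`), is `k[T]`-linear, so maps the ideal into `(c^p)`, and sends the
monomial to `T^{3m}`; `c ∣ T^{3m}` with `c` coprime to `T` makes `c` a unit. [folklore] -/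
-- adapted from `F4Isolated.monomial_notMem_span_pow` (line `ℓ = 3`, `p = 5` there)
theorem monomial_notMem_span_pow {k : Type} [Field k] (m : ℕ) (c : Polynomial k) (hcu : ¬IsUnit c)
    (hXc : ¬(Polynomial.X : Polynomial k) ∣ c) :
    (X 0 ^ (3 * m) * X 1 ^ (2 * m) * X 2 ^ (2 * m) : MvPolynomial (Fin 3) k) ∉
      Ideal.span (Set.range fun j : Fin 3 =>
        (if j = (0 : Fin 3) then Polynomial.aeval (X 0 : MvPolynomial (Fin 3) k) c else X j) ^ (2 * m + 1)) := by
  classical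
  intro hmem
  obtain ⟨a, ha_def⟩ : ∃ a : Fin 3 →₀ ℕ, a = Finsupp.single 1 (2 * m) + Finsupp.single 2 (2 * m) := ⟨_, rfl⟩
  obtain ⟨E, hE⟩ := FedderAlongCoordinateLine.exists_extraction (k := k) (0 : Fin 3) a
  have ha : a 0 = 0 := by
    rw [ha_def, Finsupp.add_apply, Finsupp.single_eq_of_ne (by decide),
      Finsupp.single_eq_of_ne (by decide), add_zero]
  have hap : ∀ j : Fin 3, a j < 2 * m + 1 := by
    intro j
    rw [ha_def, Finsupp.add_apply, Finsupp.single_apply, Finsupp.single_apply]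
    split_ifs <;> omega
  -- `E (X₁^{2m} X₂^{2m}) = 1`
  have hmon : (X 1 ^ (2 * m) * X 2 ^ (2 * m) : MvPolynomial (Fin 3) k) = monomial a 1 := by
    rw [X_pow_eq_monomial, X_pow_eq_monomial, monomial_mul, one_mul, ha_def]
  have hE1 : E (X 1 ^ (2 * m) * X 2 ^ (2 * m)) = 1 := by
    ext t
    rw [hE, hmon, coeff_monomial, Polynomial.coeff_one]
    by_cases ht : t = 0
    · rw [if_pos ht, if_pos (by rw [ht, Finsupp.single_zero, add_zero])]
    · rw [if_neg ht, if_neg]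
      intro h
      have h0 := DFunLike.congr_fun h 0
      rw [Finsupp.add_apply, ha, Finsupp.single_eq_same, zero_add] at h0
      exact ht h0.symm
  -- `E (X₀^{3m} X₁^{2m} X₂^{2m}) = T^{3m}`
  have hEM : E (X 0 ^ (3 * m) * X 1 ^ (2 * m) * X 2 ^ (2 * m)) = Polynomial.X ^ (3 * m) := by
    have h := FedderAlongCoordinateLine.extraction_mul_aeval hE ha
      (Polynomial.aeval (X 0 : MvPolynomial (Fin 3) k)) rfl (X 1 ^ (2 * m) * X 2 ^ (2 * m))
      (Polynomial.X ^ (3 * m))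
    rw [map_pow, Polynomial.aeval_X, hE1, one_mul] at h
    rw [show (X 0 ^ (3 * m) * X 1 ^ (2 * m) * X 2 ^ (2 * m) : MvPolynomial (Fin 3) k) =
      X 1 ^ (2 * m) * X 2 ^ (2 * m) * X 0 ^ (3 * m) by ring]
    exact h
  -- `E` maps the ideal into `(c^p)`
  obtain ⟨h, hh⟩ := Ideal.mem_span_range_iff_exists_fun.mp hmem
  have hEf : E (X 0 ^ (3 * m) * X 1 ^ (2 * m) * X 2 ^ (2 * m)) = E (h 0) * c ^ (2 * m + 1) := by
    rw [← hh, map_sum, Finset.sum_eq_single (0 : Fin 3)]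
    · rw [if_pos rfl, ← map_pow, FedderAlongCoordinateLine.extraction_mul_aeval hE ha _ rfl]
    · intro j _ hj
      rw [if_neg hj, FedderAlongCoordinateLine.extraction_mul_X_pow hE hj (hap j)]
    · intro h0
      exact absurd (Finset.mem_univ _) h0
  -- `c ∣ T^{3m}`, `c` coprime to `T`: `c` is a unit
  have hdvdp : c ^ (2 * m + 1) ∣ (Polynomial.X : Polynomial k) ^ (3 * m) :=
    ⟨E (h 0), by rw [← hEM, hEf, mul_comm]⟩
  have hdvd : c ∣ (Polynomial.X : Polynomial k) ^ (3 * m) :=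
    (dvd_pow_self c (by omega : (2 * m + 1 : ℕ) ≠ 0)).trans hdvdp
  have hcop : IsCoprime (Polynomial.X : Polynomial k) c :=
    (Polynomial.irreducible_X.coprime_iff_not_dvd).mpr hXc
  exact hcu (hcop.pow_left.isUnit_of_dvd' hdvd (dvd_refl c))

/-! ## §4 The off-origin clause at every odd prime -/

/-- **THE OFF-ORIGIN CLAUSE FOR `g = X₂² + X₀³X₁² + X₁³` AT EVERY ODD PRIME** (input `hoff` of the graded engine G5):
over a field `k` of odd characteristic `p`, at every maximal ideal `Q` of `k[X]/(g)` missing some variable the local ring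
satisfies the per-stalk clause of the crux.  With `P = Q ∩ k[X]`: if `∂₂g = 2X₂ ∉ P` or `∂₁g = X₁(2X₀³ + 3X₁) ∉ P`, the
Jacobian discharger `ClauseOfPderivNotMem.stub_clauseOfPderivNotMem`; otherwise `X₂ ∈ P` and `X₁ ∈ P` (from `g ∈ P`:
`X₁²(X₀³ + X₁) ∈ P`, and `X₁ ∉ P` would give `X₀³ + X₁ ∈ P`, `2X₀³ + 3X₁ ∈ P`, hence `X₁ ∈ P`), so `X₀ ∉ P`,
`P = (c(X₀), X₁, X₂)` for a non-unit `c` coprime to `T` (`FedderAlongCoordinateLine.exists_eq_span_of_X_mem`; `T ∣ c` would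
put `P` inside `(X₀,X₁,X₂)`), and Fedder's test `g^(p-1) ∉ (c(X₀)^p, X₁^p, X₂^p)` holds: `g^(p-1) ≡ C(2m,m)·X₀^{3m}X₁^{2m}X₂^{2m}`
(`g_pow_sub_mem`), the coefficient is a unit (`choose_ne_zero`) and the monomial is not in the ideal
(`monomial_notMem_span_pow`); conclude by `FedderAtMaximalIdeal.stub_fedderAtMaximalIdeal`.
[cite: Fedder1983, Prop. 1.7 and Thm. 1.12] -/
theorem g1Corner_offOrigin_clause (p : ℕ) [hp : Fact p.Prime] (hp2 : p ≠ 2) (k : Type) [Field k] [CharP k p]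
    (g : MvPolynomial (Fin 3) k) (hg : g = X 2 ^ 2 + X 0 ^ 3 * X 1 ^ 2 + X 1 ^ 3) :
    ∀ (Q : Ideal (MvPolynomial (Fin 3) k ⧸ Ideal.span {g})) [Q.IsMaximal],
      (∃ j : Fin 3, Ideal.Quotient.mk (Ideal.span {g}) (MvPolynomial.X j) ∉ Q) →
      ∀ d : ℕ, ringKrullDim (Localization.AtPrime Q) = d → ∀ s : Fin d → Localization.AtPrime Q,
        (Ideal.span (Set.range s)).radical.IsMaximal →
          RingTheory.Sequence.IsWeaklyRegular (Localization.AtPrime Q) (List.ofFn s) ∧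
          ∀ y : Localization.AtPrime Q, (∃ e : ℕ, y ^ p ^ e ∈ Ideal.span
            ((fun z : Localization.AtPrime Q => z ^ p ^ e) ''
              (Ideal.span (Set.range s) : Set (Localization.AtPrime Q)))) → y ∈ Ideal.span (Set.range s) := by
  intro Q _ hQ d hd s hs
  obtain ⟨m, hm⟩ : ∃ m : ℕ, p = 2 * m + 1 := by
    rcases hp.out.eq_two_or_odd with h2 | hodd
    exacts [absurd h2 hp2, ⟨p / 2, by omega⟩]
  -- `P = Q ∩ k[X]`, a maximal ideal of `k[X]` containing `g`
  haveI hPmax : (Q.comap (Ideal.Quotient.mk (Ideal.span {g}))).IsMaximal :=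
    Ideal.comap_isMaximal_of_surjective _ Ideal.Quotient.mk_surjective
  have hP := hPmax.isPrime
  have hgP : g ∈ Q.comap (Ideal.Quotient.mk (Ideal.span {g})) := by
    rw [Ideal.mem_comap, Ideal.Quotient.eq_zero_iff_mem.mpr (Ideal.mem_span_singleton_self g)]
    exact Q.zero_mem
  -- `2` is a unit in `k[X]` (`p` odd)
  have h2k : (2 : k) ≠ 0 := by
    intro h
    have h' : ((2 : ℕ) : k) = 0 := by exact_mod_cast h
    rw [CharP.cast_eq_zero_iff k p] at h'
    have := (Nat.prime_dvd_prime_iff_eq hp.out Nat.prime_two).mp h'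
    exact hp2 this
  have hu2 : IsUnit (2 : MvPolynomial (Fin 3) k) := by
    have h := (isUnit_iff_ne_zero.mpr h2k).map (MvPolynomial.C : k →+* MvPolynomial (Fin 3) k)
    rwa [map_ofNat] at h
  -- the partial derivatives
  have hd2 : pderiv 2 g = 2 * X 2 := by rw [hg, pderiv_two_g]
  have hd1 : pderiv 1 g = 2 * (X 0 ^ 3 * X 1) + 3 * X 1 ^ 2 := by rw [hg, pderiv_one_g]
  -- off the singular line: Jacobian discharger
  by_cases hm2 : pderiv 2 g ∈ Q.comap (Ideal.Quotient.mk (Ideal.span {g})); swap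
  · exact ClauseOfPderivNotMem.stub_clauseOfPderivNotMem p k 3 g Q 2 hm2 d hd s hs
  by_cases hm1 : pderiv 1 g ∈ Q.comap (Ideal.Quotient.mk (Ideal.span {g})); swap
  · exact ClauseOfPderivNotMem.stub_clauseOfPderivNotMem p k 3 g Q 1 hm1 d hd s hs
  -- on the singular line: `X₂, X₁ ∈ P`, `X₀ ∉ P`
  have hX2 : (X 2 : MvPolynomial (Fin 3) k) ∈ Q.comap (Ideal.Quotient.mk (Ideal.span {g})) := by
    rw [hd2] at hm2
    exact (Ideal.unit_mul_mem_iff_mem _ hu2).mp hm2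
  have hX1 : (X 1 : MvPolynomial (Fin 3) k) ∈ Q.comap (Ideal.Quotient.mk (Ideal.span {g})) := by
    by_contra hX1
    -- `X₁²(X₀³ + X₁) = g - X₂² ∈ P`, so `X₀³ + X₁ ∈ P`
    have e1 : (X 1 ^ 2 * (X 0 ^ 3 + X 1) : MvPolynomial (Fin 3) k) = g - X 2 * X 2 := by rw [hg]; ring
    have h1 : (X 1 ^ 2 * (X 0 ^ 3 + X 1) : MvPolynomial (Fin 3) k) ∈
        Q.comap (Ideal.Quotient.mk (Ideal.span {g})) := by
      rw [e1]
      exact Ideal.sub_mem _ hgP (Ideal.mul_mem_left _ _ hX2)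
    rcases hP.mem_or_mem h1 with h12 | h01
    · exact hX1 (hP.mem_of_pow_mem 2 h12)
    -- `X₁(2X₀³ + 3X₁) = ∂₁g ∈ P`, so `2X₀³ + 3X₁ ∈ P`
    have e2 : (X 1 * (2 * X 0 ^ 3 + 3 * X 1) : MvPolynomial (Fin 3) k) = pderiv 1 g := by rw [hd1]; ring
    have h2 : (X 1 * (2 * X 0 ^ 3 + 3 * X 1) : MvPolynomial (Fin 3) k) ∈
        Q.comap (Ideal.Quotient.mk (Ideal.span {g})) := by
      rw [e2]; exact hm1
    rcases hP.mem_or_mem h2 with h1' | h23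
    · exact hX1 h1'
    -- then `X₁ = (2X₀³ + 3X₁) - 2(X₀³ + X₁) ∈ P`
    have e3 : (X 1 : MvPolynomial (Fin 3) k) = (2 * X 0 ^ 3 + 3 * X 1) - 2 * (X 0 ^ 3 + X 1) := by ring
    exact hX1 (e3 ▸ Ideal.sub_mem _ h23 (Ideal.mul_mem_left _ _ h01))
  have hX0 : (X 0 : MvPolynomial (Fin 3) k) ∉ Q.comap (Ideal.Quotient.mk (Ideal.span {g})) := by
    obtain ⟨j, hj⟩ := hQ
    intro hX0
    apply hj
    rw [← Ideal.mem_comap]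
    fin_cases j
    exacts [hX0, hX1, hX2]
  have hXP : ∀ j : Fin 3, j ≠ 0 →
      (X j : MvPolynomial (Fin 3) k) ∈ Q.comap (Ideal.Quotient.mk (Ideal.span {g})) := by
    intro j hj
    fin_cases j
    · exact absurd rfl hj
    · exact hX1
    · exact hX2
  -- `P = (c(X₀), X₁, X₂)` for a non-unit `c ∈ k[T]`, coprime to `T`
  obtain ⟨c, hcu, hPc⟩ := FedderAlongCoordinateLine.exists_eq_span_of_X_mem k 3 (0 : Fin 3)
    (Polynomial.aeval (X 0 : MvPolynomial (Fin 3) k)) rfl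
    (Q.comap (Ideal.Quotient.mk (Ideal.span {g}))) hXP
  have hXc : ¬(Polynomial.X : Polynomial k) ∣ c := by
    rintro ⟨c', rfl⟩
    apply hX0
    -- `P ≤ (X₀, X₁, X₂) ≠ ⊤`, so `P = (X)` contains `X₀`
    have hle : Q.comap (Ideal.Quotient.mk (Ideal.span {g})) ≤
        Ideal.span (Set.range (X : Fin 3 → MvPolynomial (Fin 3) k)) := by
      rw [hPc, Ideal.span_le]
      rintro _ ⟨j, rfl⟩
      by_cases hj : j = 0
      · show (if j = 0 then Polynomial.aeval (X 0 : MvPolynomial (Fin 3) k) (Polynomial.X * c')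
          else X j) ∈ Ideal.span (Set.range (X : Fin 3 → MvPolynomial (Fin 3) k))
        rw [if_pos hj, map_mul, Polynomial.aeval_X]
        exact Ideal.mul_mem_right _ _ (Ideal.subset_span ⟨0, rfl⟩)
      · show (if j = 0 then Polynomial.aeval (X 0 : MvPolynomial (Fin 3) k) (Polynomial.X * c')
          else X j) ∈ Ideal.span (Set.range (X : Fin 3 → MvPolynomial (Fin 3) k))
        rw [if_neg hj]
        exact Ideal.subset_span ⟨j, rfl⟩
    have hne : Ideal.span (Set.range (X : Fin 3 → MvPolynomial (Fin 3) k)) ≠ ⊤ :=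
      (Fedder.isMaximal_span_range_X k 3).ne_top
    rw [hPmax.eq_of_le hne hle]
    exact Ideal.subset_span ⟨0, rfl⟩
  have hg0 : g ≠ 0 := (prime_g k g hg).ne_zero
  -- the coefficient `C(2m, m)` is a unit in `k[X]`
  have huC : IsUnit (((2 * m).choose m : ℕ) : MvPolynomial (Fin 3) k) := by
    have h := (isUnit_iff_ne_zero.mpr (choose_ne_zero p m hm k)).map (MvPolynomial.C : k →+* MvPolynomial (Fin 3) k)
    rwa [map_natCast] at h
  -- Fedder's test at `P`
  have hfed : g ^ (p - 1) ∉ Ideal.span (Set.range fun i : Fin 3 =>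
      (if i = (0 : Fin 3) then Polynomial.aeval (X 0 : MvPolynomial (Fin 3) k) c else X i) ^ p) := by
    intro hmem
    rw [hm] at hmem
    apply monomial_notMem_span_pow m c hcu hXc
    have hXJ : ∀ j : Fin 3, j ≠ 0 → (X j : MvPolynomial (Fin 3) k) ^ (2 * m + 1) ∈
        Ideal.span (Set.range fun i : Fin 3 =>
          (if i = (0 : Fin 3) then Polynomial.aeval (X 0 : MvPolynomial (Fin 3) k) c else X i) ^ (2 * m + 1)) :=
      fun j hj => Ideal.subset_span ⟨j, by simp only [if_neg hj]⟩
    rw [hg, show (2 * m + 1 - 1 : ℕ) = 2 * m from rfl] at hmem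
    have h6 := Ideal.sub_mem _ hmem (g_pow_sub_mem m (X 0) (X 1) (X 2) _
      (hXJ 1 (by decide)) (hXJ 2 (by decide)))
    rw [sub_sub_cancel] at h6
    exact (Ideal.unit_mul_mem_iff_mem _ huC).mp (by exact_mod_cast h6)
  exact FedderAtMaximalIdeal.stub_fedderAtMaximalIdeal p k 3 3
    (fun j : Fin 3 => if j = (0 : Fin 3) then Polynomial.aeval (X 0 : MvPolynomial (Fin 3) k) c
      else X j) g Q hPc hg0 hfed d hd s hs

end Summit.ResolutionOfSingularities.ResolutionOfSingularities.Theorems.FInjectiveMacaulayfication.G1CornerGradedData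

end
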